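import Summits.BirchSwinnertonDyer.BirchSwinnertonDyer.Theorems.ClassRecordThreeCornerAtThreeModThreeCommutatorNegOne
import Summits.BirchSwinnertonDyer.BirchSwinnertonDyer.Theorems.ClassRecordThreeCornerAtThreeModThreeNoncommutingPair
import Summits.BirchSwinnertonDyer.BirchSwinnertonDyer.Theorems.ClassRecordThreeCornerAtThreeKummerExclusionCubic
import Summits.BirchSwinnertonDyer.BirchSwinnertonDyer.Theorems.ErratumRoadFiveAuxPrimeKummerDescent
import Summits.BirchSwinnertonDyer.BirchSwinnertonDyer.Theorems.ErratumRoadFiveAuxPrimeFrobeniusWitness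
import Literature.NumberTheory.EllipticCurves.ArtinFormalismAbelianGaloisLocalProofs
import HarnessLib

/-!
# The WITNESS of the split prime-conductor Chebotarev–Kummer supply (c′): `γ ∈ res(res Γ_R)`, `γ ζ = ζ`, `γ = −1` on `E[3]`, `γ α ≠ α`
# (cell `bsd-stepL`, seat `bsd-stepL-corner3-p2` g15 = lane B, LINE OWNER of crux 21420 `CornerAtThreeW`; `--supports stmt-BirchSwinnertonDyer-21420 --as helper`)

WHY. The Chebotarev step of (c′) (`ChebKummerThree.exists_splitAuxPrime_of_witness`) needs ONE `γ ∈ Γ_ℚ` with (W1) `γ ∈ res_{K/ℚ}(res_{R/K} Γ_R)`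
(trivial on the abelian `R/K` — the ring class field), (W2) `γ ζ = ζ` (`ζ` of order `3^E`), (W3) `γ • P = −P` on `E[3]`, (W4) `γ α ≠ α` for a cube
root `α` of a non-cube `x ∈ K`. THIS FILE builds it (`exists_witness`) for `E = W/ℚ` with MULTIPLICATIVE `3`, `E[3]` IRREDUCIBLE, `ρ̄_{E,3}` NOT
onto, and `K` imaginary quadratic with `3` INERT: (A1) `…ModThreeNoncommutingPair` gives `a, b ∈ Γ_K` with `ρ̄(ab) ≠ ρ̄(ba)`; (A2)
`…ModThreeCommutatorNegOne` makes `γ₀ ∈ {[a,b], [a,b]²}` act as `−1`; commutators of `Γ_K` lie in `res(Γ_R)` (`R/K` abelian, tree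
`commutator_mem_range_absGaloisRestrict`) and fix `ζ` (tree `AuxPrimeSupply.commutator_mem_range_and_smul_eq`); (B) the Kummer exclusion
`…KummerExclusionCubic` (with `P₀ = res(res Γ_R) ∩ Stab ζ`, `ρ = ρ̄_{E,3}` of order prime to `3` on `P₀` by Serre's `3 ∤ #G`, and `ω = ζ^{3^{E−1}} ∉ K`
because `3` is inert in `K`: `exists_mem_range_smul_ne_of_cubic`) supplies `n ∈ P₀ ∩ ker ρ̄` moving `α`; then `γ = γ₀` or `γ₀ n`.
HONEST FRAMING: THEOREMS ONLY (no definition, no named fact, no `sorry`); nothing about any CM point or any crux object; no stub ∕ item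
closes; 21420 OPEN; no census label moves (T7); BSD is proved for no curve.
References (locators only): [cite: GrossLMS1991, §9 (choice of Frobenius)] [cite: Serre1972, §2.4 Prop. 15] [cite: Cox2013, §5.B, §9.A].
presearch: in-tree (lane B g15 A1/A2/B files; er5 -w2 F3 files for the fixed-field and commutator lemmas). Axioms: `propext`,
`Classical.choice`, `Quot.sound`.
-/

set_option autoImplicit false
set_option linter.dupNamespace false -- `Summit.BirchSwinnertonDyer.BirchSwinnertonDyer` (summit = problem), tree-wide

noncomputable section

open scoped Classical Pointwise NumberField
open WeierstrassCurve NumberField IsDedekindDomain Field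
open Literature.NumberTheory.GaloisRepresentations Literature.NumberTheory.EllipticCurves

namespace Summit.BirchSwinnertonDyer.BirchSwinnertonDyer.Theorems.ChebKummerThree

open AuxPrimeSupply

/-! ### §1 `ω ∉ K`: a primitive cube root of unity is moved by `Γ_K` when `3` is inert in `K` -/

/-- **No primitive cube root of unity lies in `K` when `3` is inert in `K`**: if `y² + y + 1 = 0` with `y ∈ 𝓞_K` and `3𝓞_K` is a PRIME ideal,
then `(y − 1)² = −3y ∈ 3𝓞_K` forces `y ≡ 1`, whence `3 = −9(t + t²)·… ∈ 9𝓞_K`-type absurdity: precisely `y = 1 + 3t` gives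
`0 = y² + y + 1 = 3(1 + 3t + 3t²)`, so `1 ∈ 3𝓞_K`. [folklore] -/
theorem not_cubic_of_isPrime_span_three {K : Type} [Field K] [NumberField K]
    (h3 : (Ideal.span {(3 : 𝓞 K)}).IsPrime) (y : 𝓞 K) : y ^ 2 + y + 1 ≠ 0 := by
  intro hy
  set I : Ideal (𝓞 K) := Ideal.span {(3 : 𝓞 K)} with hI
  have hsq : (y - 1) ^ 2 ∈ I := by
    have e : (y - 1) ^ 2 = (y ^ 2 + y + 1) + 3 * (-y) := by ring
    rw [e, hy, zero_add]
    exact Ideal.mul_mem_right _ _ (Ideal.subset_span rfl)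
  have h1 : y - 1 ∈ I := h3.mem_of_pow_mem 2 hsq
  obtain ⟨t, ht⟩ := Ideal.mem_span_singleton'.mp h1
  have hy' : y = 1 + t * 3 := by rw [ht]; ring
  have h0 : (3 : 𝓞 K) * (1 + 3 * t + 3 * t ^ 2) = 0 := by
    rw [← hy, hy']; ring
  have h3ne : (3 : 𝓞 K) ≠ 0 := by exact_mod_cast (three_ne_zero : (3 : ℤ) ≠ 0)
  have h1' : 1 + 3 * t + 3 * t ^ 2 = 0 := (mul_eq_zero.mp h0).resolve_left h3ne
  apply h3.ne_top
  rw [Ideal.eq_top_iff_one]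
  have e : (1 : 𝓞 K) = 3 * (-(t + t ^ 2)) + (1 + 3 * t + 3 * t ^ 2) := by ring
  rw [e, h1', add_zero]
  exact Ideal.mul_mem_right _ _ (Ideal.subset_span rfl)

/-- **`Γ_K` moves every primitive cube root of unity of `ℚ̄` when `3` is inert in `K`** (`K` imaginary quadratic, `#{𝔭 ∣ 3} = 1`, `3 ∤ d_K`):
otherwise `ω` would lie in `e(K)` (fixed field of `res Γ_K`) and give a root of `X² + X + 1` in `𝓞_K`, excluded by
`not_cubic_of_isPrime_span_three` (`3𝓞_K` is prime: tree `asIdeal_eq_span_natCast_of_ncard_primesOver_eq_one`). [folklore] -/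
theorem exists_mem_range_smul_ne_of_cubic {K : Type} [Field K] [NumberField K] (hK : IsImaginaryQuadratic K)
    (h3 : ((Ideal.span {(3 : ℤ)}).primesOver (𝓞 K)).ncard = 1) (h3d : ¬ (3 : ℤ) ∣ NumberField.discr K)
    (e : K →ₐ[ℚ] AlgebraicClosure ℚ)
    (he : ∀ g : absoluteGaloisGroup ℚ, g ∈ (absGaloisRestrict ℚ K).range ↔ ∀ k : K, g • e k = e k)
    {ω : AlgebraicClosure ℚ} (hω : ω ^ 2 + ω + 1 = 0) :
    ∃ c ∈ (absGaloisRestrict ℚ K).range, c • ω ≠ ω := by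
  by_contra hall
  push Not at hall
  obtain ⟨y, hy⟩ := exists_eq_embedding_of_forall_smul e he hall
  have hyq : y ^ 2 + y + 1 = 0 := by
    have : e (y ^ 2 + y + 1) = e 0 := by rw [map_add, map_add, map_pow, map_one, hy, hω, map_zero]
    exact e.injective this
  -- `y` is integral (`y³ = 1`)
  have hy3 : y ^ 3 = 1 := by linear_combination (y - 1) * hyq
  have hyint : IsIntegral ℤ y := IsIntegral.of_pow (by norm_num : 0 < 3) (by rw [hy3]; exact isIntegral_one)
  set yI : 𝓞 K := ⟨y, hyint⟩ with hyI
  have hyIq : yI ^ 2 + yI + 1 = 0 := by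
    apply Subtype.ext
    change ((yI ^ 2 + yI + 1 : 𝓞 K) : K) = ((0 : 𝓞 K) : K)
    push_cast
    exact hyq
  -- `3𝓞_K` is prime (`3` inert)
  have hprime : (Ideal.span {(3 : 𝓞 K)}).IsPrime := by
    obtain ⟨P, hP⟩ : ((Ideal.span {(3 : ℤ)}).primesOver (𝓞 K)).Nonempty :=
      Set.nonempty_of_ncard_ne_zero (by rw [h3]; exact one_ne_zero)
    haveI := hP.1
    haveI := hP.2
    have hPne : P ≠ ⊥ := Ideal.ne_bot_of_liesOver_of_ne_bot (by
      simp : (Ideal.span {(3 : ℤ)} : Ideal ℤ) ≠ ⊥) P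
    set v : HeightOneSpectrum (𝓞 K) := ⟨P, hP.1, hPne⟩ with hv
    have h3v : ((3 : ℕ) : 𝓞 K) ∈ v.asIdeal := by
      have : ((3 : ℤ) : 𝓞 K) ∈ P := by
        have h := hP.2.over ▸ (Ideal.mem_span_singleton_self (3 : ℤ))
        rw [Ideal.mem_comap] at h
        simpa using h
      simpa using this
    have heq := asIdeal_eq_span_natCast_of_ncard_primesOver_eq_one hK Nat.prime_three h3 h3d h3v
    have : (Ideal.span {(3 : 𝓞 K)}) = v.asIdeal := by rw [heq]; norm_cast
    rw [this]; exact v.isPrime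
  exact not_cubic_of_isPrime_span_three hprime yI hyIq

/-! ### §2 The witness -/

/-- **The witness of (c′).** `E = W/ℚ` with multiplicative reduction at `3`, `E[3]` irreducible, `ρ̄_{E,3}` not onto; `K` imaginary quadratic with
`3` inert (`#{𝔭 ∣ 3} = 1`, `3 ∤ d_K`) and its embedding `e : K → ℚ̄` with `res Γ_K = Fix(e K)`; `R/K` finite ABELIAN; `E ≥ 1`, `ζ ∈ ℚ̄` primitive of
order `3^E`; `x ∈ K` NOT a cube, `α ∈ ℚ̄` with `α³ = e x`. Then some `γ ∈ Γ_ℚ` satisfies (W1) `γ ∈ res_{K/ℚ}(res_{R/K} Γ_R)`, (W2) `γ ζ = ζ`,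
(W3) `γ • P = −P` for all `P ∈ E[3]`, (W4) `γ α ≠ α`. Proof in the module docstring.
[cite: GrossLMS1991, §9] [cite: Serre1972, §2.4 Prop. 15] [cite: Cox2013, §5.B, §9.A] -/
theorem exists_witness (W : WeierstrassCurve ℚ) [W.IsElliptic] [Fact (Nat.Prime 3)]
    (hmult : W.HasMultiplicativeReductionAtPrime 3) (hirr : W.HasIrreducibleModPGaloisRep 3) (hns : ¬ W.HasSurjectiveModNGaloisRep 3)
    {K : Type} [Field K] [NumberField K] (hK : IsImaginaryQuadratic K)
    (h3 : ((Ideal.span {(3 : ℤ)}).primesOver (𝓞 K)).ncard = 1) (h3d : ¬ (3 : ℤ) ∣ NumberField.discr K)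
    (e : K →ₐ[ℚ] AlgebraicClosure ℚ)
    (he : ∀ g : absoluteGaloisGroup ℚ, g ∈ (absGaloisRestrict ℚ K).range ↔ ∀ k : K, g • e k = e k)
    (R : Type) [Field R] [NumberField R] [Algebra K R] [FiniteDimensional K R] [IsAbelianGalois K R]
    {E : ℕ} (hE : 1 ≤ E) {ζ : AlgebraicClosure ℚ} (hζ : IsPrimitiveRoot ζ (3 ^ E))
    {x : K} (hx : ∀ y : K, y ^ 3 ≠ x) {α : AlgebraicClosure ℚ} (hα : α ^ 3 = e x) :
    ∃ γ : absoluteGaloisGroup ℚ, γ ∈ ((absGaloisRestrict K R).range).map (absGaloisRestrict ℚ K).toMonoidHom ∧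
      γ • ζ = ζ ∧ (∀ P : geomTorsion W (3 : ℕ), γ • P = -P) ∧ γ • α ≠ α := by
  haveI : NeZero (3 ^ E) := ⟨pow_ne_zero E three_ne_zero⟩
  set H := (absGaloisRestrict ℚ K).range with hHdef
  set HR := ((absGaloisRestrict K R).range).map (absGaloisRestrict ℚ K).toMonoidHom with hHRdef
  have hHRH : HR ≤ H := by rintro g ⟨δ, -, rfl⟩; exact ⟨δ, rfl⟩
  set ρ := galoisRepTorsion W (3 : ℕ) with hρ
  -- commutators of `H`: in `HR` and fixing `ζ`
  have hcommHR : ∀ a ∈ H, ∀ b ∈ H, a * b * a⁻¹ * b⁻¹ ∈ HR := by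
    rintro a ⟨α', rfl⟩ b ⟨β', rfl⟩
    refine ⟨α' * β' * α'⁻¹ * β'⁻¹, commutator_mem_range_absGaloisRestrict K R α' β', ?_⟩
    simp only [map_mul, map_inv]
  have hcommζ : ∀ a b : absoluteGaloisGroup ℚ, (a * b * a⁻¹ * b⁻¹) • ζ = ζ := fun a b ↦
    (commutator_mem_range_and_smul_eq hK.1 hE hζ a b).2
  -- (A1)+(A2): `γ₀ ∈ {c, c²}` acting as `-1`
  obtain ⟨a, ha, b, hb, hab⟩ := exists_noncommuting_pair_of_mult_of_irr W hmult hirr K hK h3 h3d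
  set c := a * b * a⁻¹ * b⁻¹ with hc
  have hcHR : c ∈ HR := hcommHR a ha b hb
  have hcζ : c • ζ = ζ := hcommζ a b
  obtain ⟨γ₀, hγ₀HR, hγ₀ζ, hγ₀neg⟩ : ∃ γ₀ : absoluteGaloisGroup ℚ, γ₀ ∈ HR ∧ γ₀ • ζ = ζ ∧
      ∀ P : geomTorsion W (3 : ℕ), γ₀ • P = -P := by
    rcases smul_eq_neg_or_sq_smul_eq_neg_of_commutator W hirr hns hab with h | h
    · exact ⟨c, hcHR, hcζ, h⟩
    · exact ⟨c * c, HR.mul_mem hcHR hcHR, by rw [mul_smul, hcζ, hcζ], h⟩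
  -- (B): the Kummer exclusion over `P₀ = HR ∩ Stab ζ`
  set P₀ : Subgroup (absoluteGaloisGroup ℚ) := HR ⊓ MulAction.stabilizer (absoluteGaloisGroup ℚ) ζ with hP₀
  have hmemP₀ : ∀ g, g ∈ P₀ ↔ g ∈ HR ∧ g • ζ = ζ := fun g ↦ by
    rw [hP₀, Subgroup.mem_inf, MulAction.mem_stabilizer_iff]
  have hP₀H : P₀ ≤ H := fun g hg ↦ hHRH ((hmemP₀ g).mp hg).1
  have hcommP₀ : ∀ a ∈ H, ∀ b ∈ H, a * b * a⁻¹ * b⁻¹ ∈ P₀ := fun a ha b hb ↦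
    (hmemP₀ _).mpr ⟨hcommHR a ha b hb, hcommζ a b⟩
  -- `ρ̄(p)` has order prime to `3` (`3 ∤ #ρ̄(Γ_ℚ)`)
  have hρ3 : ∀ p ∈ P₀, ∃ k : ℕ, ¬ 3 ∣ k ∧ ρ (p ^ k) = 1 := by
    intro p _
    obtain ⟨ef, Φ, hef, -⟩ := exists_frame_galoisRepTorsion_rat W 3
    have hG : ¬ 3 ∣ Nat.card (ρ.range.map Φ.toMonoidHom) :=
      W.not_dvd_card_of_not_hasSurjectiveModNGaloisRep 3 Φ ef hef hirr hns
    refine ⟨orderOf (ρ p), ?_, by rw [map_pow, pow_orderOf_eq_one]⟩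
    have hmem : Φ (ρ p) ∈ ρ.range.map Φ.toMonoidHom := Subgroup.mem_map.mpr ⟨ρ p, ⟨p, rfl⟩, rfl⟩
    have hdvd : orderOf (⟨Φ (ρ p), hmem⟩ : ρ.range.map Φ.toMonoidHom) ∣ Nat.card (ρ.range.map Φ.toMonoidHom) :=
      orderOf_dvd_natCard _
    rw [Subgroup.orderOf_mk, MulEquiv.orderOf_eq] at hdvd
    exact fun h ↦ hG (h.trans hdvd)
  -- the primitive cube root of unity `ω = ζ^{3^{E-1}}`
  set ω : AlgebraicClosure ℚ := ζ ^ (3 ^ (E - 1)) with hωdef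
  have hω3 : ω ^ 3 = 1 := by
    rw [hωdef, ← pow_mul, ← pow_succ, Nat.sub_add_cancel hE]; exact hζ.pow_eq_one
  have hω1 : ω ≠ 1 := by
    rw [hωdef]
    intro h
    have hd := (hζ.pow_eq_one_iff_dvd (3 ^ (E - 1))).mp h
    have hlt : 3 ^ (E - 1) < 3 ^ E := Nat.pow_lt_pow_right (by norm_num) (by omega)
    exact absurd (Nat.le_of_dvd (pow_pos (by norm_num) _) hd) (not_le.mpr hlt)
  have hω : ω ^ 2 + ω + 1 = 0 := by
    have hfac : (ω - 1) * (ω ^ 2 + ω + 1) = 0 := by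
      have : (ω - 1) * (ω ^ 2 + ω + 1) = ω ^ 3 - 1 := by ring
      rw [this, hω3, sub_self]
    exact (mul_eq_zero.mp hfac).resolve_left (sub_ne_zero.mpr hω1)
  have hP₀ω : ∀ p ∈ P₀, p • ω = ω := fun p hp ↦ by
    rw [hωdef, smul_pow', ((hmemP₀ p).mp hp).2]
  have hHω : ∃ c ∈ H, c • ω ≠ ω := exists_mem_range_smul_ne_of_cubic hK h3 h3d e he hω
  have hHx : ∀ h ∈ H, h • e x = e x := fun h hh ↦ (he h).mp hh x
  have hfix : ∀ y : AlgebraicClosure ℚ, (∀ h ∈ H, h • y = y) → y ^ 3 ≠ e x := by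
    intro y hy hy3
    obtain ⟨k, hk⟩ := exists_eq_embedding_of_forall_smul e he hy
    have : e (k ^ 3) = e x := by rw [map_pow, hk, hy3]
    exact hx k (e.injective this)
  have h3ne : (3 : AlgebraicClosure ℚ) ≠ 0 := by norm_num
  obtain ⟨n, hnP₀, hρn, hnα⟩ :=
    exists_mem_map_eq_one_smul_ne h3ne hP₀H hcommP₀ ρ hρ3 hω hP₀ω hHω hHx hfix hα
  obtain ⟨hnHR, hnζ⟩ := (hmemP₀ n).mp hnP₀
  have hnP : ∀ P : geomTorsion W (3 : ℕ), n • P = P := fun P ↦ by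
    rw [← galoisRepTorsion_apply, ← hρ, hρn]; rfl
  -- the witness: `γ₀` if it moves `α`, else `γ₀ n`
  by_cases hγ₀α : γ₀ • α = α
  · refine ⟨γ₀ * n, HR.mul_mem hγ₀HR hnHR, by rw [mul_smul, hnζ, hγ₀ζ], fun P ↦ by rw [mul_smul, hnP, hγ₀neg], ?_⟩
    intro h
    apply hnα
    have := congrArg (fun t ↦ γ₀⁻¹ • t) h
    simp only [mul_smul, inv_smul_smul] at this
    rw [this]
    have h' := congrArg (fun t ↦ γ₀⁻¹ • t) hγ₀α
    simp only [inv_smul_smul] at h'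
    exact h'.symm
  · exact ⟨γ₀, hγ₀HR, hγ₀ζ, hγ₀neg, hγ₀α⟩

end Summit.BirchSwinnertonDyer.BirchSwinnertonDyer.Theorems.ChebKummerThree

end
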